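import Literature.MathematicalPhysics.QuantumFieldTheory.Balaban1983to89.B9Eq326ConjugatedDeltaATowerTwoBackgrounds
import Literature.MathematicalPhysics.QuantumFieldTheory.Balaban1983to89.B9Eq310HessianModePairingTwoBackgrounds

/-!
# `Balaban1983to89.B9Eq326ConjugatedDeltaATowerTwoBackgroundsCloseness` — T. Bałaban, *Propagators for lattice gauge theories in a background field*, Commun.
# Math. Phys. **99** (1985) 389–434 [Balaban1985BackgroundPropagators] (3.70)–(3.73) pp. 404–405 with (3.26) p. 395, (3.49) p. 399, Thm 3.4 p. 400, Thm 3.11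
# p. 416: **THE TWO-BACKGROUND DIFFERENCE OF THE CONJUGATED `k`-LEVEL BOND PROPAGATOR AT THE BOND-CLOSENESS WINDOW `‖U(b) − V(b)‖ ≤ δη` — the curl and
# divergence closeness letters `e₁ = 8√d·M_φM_φ′·δ`, `e₂ = 2√d·M_φM_φ′·δ` of `B9Eq326ConjugatedDeltaATowerTwoBackgrounds.norm_conjG1k_sub_conjG1k_le` DISCHARGED
# (zeroth order, NO `η`)** — a corollary; the `R_k`- and `Q_k`-Lipschitz letters and the conjugated letters stay displayed

statement-level skeleton of published theorems with citation tags; proofs where landed; nothing here is a claim about the Yang–Mills mass gap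

CITATION HEADER (lean-in-tree rule).  Audit cell `pub-balaban`, sub-cell `t4`, BINDER row NE9; filed by NE9 formalisation-swarm LEAF PROVER 01
(`b2b-balaban-t4-ne9-formalise-leaf-01`, gen 88) under the fallback offer O-leaf01-g88-2 (the `e`-adapters, «NOT claimed» by ne9-leaf-04 g81, cell journal
2026-08-25 l.63833).  Imports this lineage's `B9Eq326ConjugatedDeltaATowerTwoBackgrounds` and ne9-leaf-04's `B9Eq310HessianModePairingTwoBackgrounds`
(`norm_covCurlL2K_sub_le_closeness`, `norm_adTransportW_sub_adTransportW_le`; through it `B9Eq373DerivativeRemainderTwoBackgrounds.norm_covDivL2K_sub_le₂`).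
Sources READ first-hand in the held text layer (`paper:balaban1985-cmp99-background-propagators`, journal page = PDF page + 388): pp. 404–405 (3.70)–(3.73) (the
first-order remainders between two backgrounds: *«R(U′U(b)) − R(U(b)) = (exp(ηi ad A) − 1)R(U(b))»*), p. 400 Thm 3.4, p. 416 Thm 3.11.  Nothing of print's rate
or radius is asserted; the conjugation is the ROUTE's Combes–Thomas substitute.

WHAT IS PROVED (sorry-free; proof lane — no `def`; [folklore] composition BY NAME).
* **`norm_conjG1k_sub_conjG1k_le_of_closeness`** — `…TowerTwoBackgrounds.norm_conjG1k_sub_conjG1k_le` with `uB₁ := norm_covCurlL2K_sub_le_closeness`,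
  `uB₂ := norm_covDivL2K_sub_le₂` at the transporter difference `2M_φM_φ′δη` and the scalar `η⁻¹` (`‖η⁻¹‖·η = 1`): `δ_N = 8√dM_φM_φ′δ + 2M_φM_φ′δ√d +
  e_R(1 + C_P) + √a·e_Q`.
MODEL ∕ HONEST SCOPE.  As the parent: every Thm-3.11-currency letter displayed twice; the eight conjugated letters and `e_R`, `e_Q` displayed; first order; no rate,
no window evaluated; the read-out to block decay is the consumer's line.  NOT NE9 (cell pub-balaban: NE9 NOT PRINTED ∕ NOT PROVED; «NE9 ⇐ the named binders»;
row WALLED ON A MODEL (O-NE9-1; #5 UNRULED); spine PROVED 0∕9; rung (B)+1 on a finite T⁴ — NOT infinite volume, NOT mass gap, NOT BetaPertH, NOT Clay).  HONEST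
DEPENDENCY (cell line): continuum YM on T⁴ ⇐ BetaPertH ∧ nine spine estimates (0/9 proved); BetaPertH ⇐ (D1) ∧ (D4) ∧ CAP+tail; G-an2-4 gates asym, D1 and
NE2/3/4.  NEW file; nothing modified.  Net new unproved facts: 0.
-/

noncomputable section

open scoped InnerProductSpace ComplexConjugate BigOperators

namespace Literature.MathematicalPhysics.QuantumFieldTheory.Balaban1983to89.B9Eq326ConjugatedDeltaATowerTwoBackgroundsCloseness

open B4Sect5Torus (TSite)
open B9SectCLatticeCarrier (Bond bpos btgt)
open B9Eq311L2Pairing (WL2)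
open B7Prop1Explicit (U1)
open B9Eq315QTower (towerP)
open B9Eq315QTorus (perCfg cornerSite)
open B7Prop1Explicit (Wcx boxVec)
open B11Eq103H1Complex (SiteL2K BondL2K covDerivL2K covDivL2K)
open B9Eq310HessianOperator (adTransportW PlaqL2K covCurlL2K covCoCurlL2K curvOp)
open B9Eq326OperatorTower (laplaceAk RofUk G1k QkW)
open B9Eq326ConjugatedDeltaATower (conj_inv_eta')
open B9Eq326ConjugatedDeltaATowerTwoBackgrounds (norm_conjG1k_sub_conjG1k_le)
open B9Eq310HessianModePairingTwoBackgrounds (norm_covCurlL2K_sub_le_closeness norm_adTransportW_sub_adTransportW_le)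
open B9Eq373DerivativeRemainderTwoBackgrounds (norm_covDivL2K_sub_le₂)

variable {d : ℕ} (L : ℕ) [NeZero L] (m : Fin d → ℕ) [∀ i, NeZero (m i)] (n : ℕ)
  {𝔸 : Type*} [NormedRing 𝔸] [StarRing 𝔸] [NormedAlgebra ℂ 𝔸] [StarModule ℂ 𝔸] [CompleteSpace 𝔸] [NormOneClass 𝔸]
  {W : Type*} [NormedAddCommGroup W] [InnerProductSpace ℂ W] [FiniteDimensional ℂ W] (φ : W ≃ₗ[ℂ] 𝔸) {Mφ Mφ' : ℝ}
  (hφ : ∀ w, ‖φ w‖ ≤ Mφ * ‖w‖) (hφ' : ∀ X, ‖φ.symm X‖ ≤ Mφ' * ‖X‖) (hMφ : 0 ≤ Mφ) (hMφ' : 0 ≤ Mφ')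
  {c₀ : ℝ} [Fact (0 < c₀)] {c₁ : ℝ} [Fact (0 < c₁)] {η : ℝ} (hη : 0 < η)
  (U V : Bond d (towerP L m (n + 1)) → 𝔸ˣ) (hU : ∀ b, U b ∈ U1 𝔸) (hV : ∀ b, V b ∈ U1 𝔸)
  (hRSU : ∀ (b : Bond d (towerP L m (n + 1))) (v u : W), ⟪adTransportW φ U b v, u⟫_ℂ = ⟪v, adTransportW φ (fun b => (U b)⁻¹) b u⟫_ℂ)
  (hRSV : ∀ (b : Bond d (towerP L m (n + 1))) (v u : W), ⟪adTransportW φ V b v, u⟫_ℂ = ⟪v, adTransportW φ (fun b => (V b)⁻¹) b u⟫_ℂ)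
  (τ : 𝔸 →ₗ[ℂ] ℂ) (hL : 1 ≤ L) (α : ℕ → ℝ) (hα1 : ∀ j, α j ≤ 1 / 64)
  (hU1U : ∀ (j : ℕ) (x : B7Prop1Explicit.Site d) (κ : Fin d), perCfg (towerP L m (j + 1)) (B9Eq315QTower.UlevOf L m (n + 1) U j) x κ ∈ U1 𝔸)
  (hregU : ∀ (j : ℕ) (y : TSite d (towerP L m j)) (κ : Fin d) (r : Fin d → Fin L),
    ‖((Wcx L (perCfg (towerP L m (j + 1)) (B9Eq315QTower.UlevOf L m (n + 1) U j)) (cornerSite L y) κ (boxVec L r) : 𝔸ˣ) : 𝔸) - 1‖ ≤ α j)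
  (hU1V : ∀ (j : ℕ) (x : B7Prop1Explicit.Site d) (κ : Fin d), perCfg (towerP L m (j + 1)) (B9Eq315QTower.UlevOf L m (n + 1) V j) x κ ∈ U1 𝔸)
  (hregV : ∀ (j : ℕ) (y : TSite d (towerP L m j)) (κ : Fin d) (r : Fin d → Fin L),
    ‖((Wcx L (perCfg (towerP L m (j + 1)) (B9Eq315QTower.UlevOf L m (n + 1) V j)) (cornerSite L y) κ (boxVec L r) : 𝔸ˣ) : 𝔸) - 1‖ ≤ α j)
  (a : ℝ)
  {κ : ℂ} {χ : TSite d (towerP L m (n + 1)) → ℝ}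
  {S Sinv : BondL2K ℂ d (towerP L m (n + 1)) c₀ W →ₗ[ℂ] BondL2K ℂ d (towerP L m (n + 1)) c₀ W}
  (hS : ∀ (g : BondL2K ℂ d (towerP L m (n + 1)) c₀ W) (b : Bond d (towerP L m (n + 1))),
    WL2.equiv ℂ (fun _ : Bond d (towerP L m (n + 1)) => c₀) W (S g) b =
      Complex.exp (κ * (χ (bpos b) : ℂ)) • WL2.equiv ℂ (fun _ : Bond d (towerP L m (n + 1)) => c₀) W g b)
  (hSinv : ∀ (g : BondL2K ℂ d (towerP L m (n + 1)) c₀ W) (b : Bond d (towerP L m (n + 1))),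
    WL2.equiv ℂ (fun _ : Bond d (towerP L m (n + 1)) => c₀) W (Sinv g) b =
      Complex.exp (-(κ * (χ (bpos b) : ℂ))) • WL2.equiv ℂ (fun _ : Bond d (towerP L m (n + 1)) => c₀) W g b)
  {SP SPinv : PlaqL2K ℂ d (towerP L m (n + 1)) c₀ W →ₗ[ℂ] PlaqL2K ℂ d (towerP L m (n + 1)) c₀ W}
  (hSP : ∀ (g : PlaqL2K ℂ d (towerP L m (n + 1)) c₀ W) (p : B9SectCLatticeCarrier.Plaq d (towerP L m (n + 1))),
    WL2.equiv ℂ (fun _ : B9SectCLatticeCarrier.Plaq d (towerP L m (n + 1)) => c₀) W (SP g) p =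
      Complex.exp (κ * (χ p.1 : ℂ)) • WL2.equiv ℂ (fun _ : B9SectCLatticeCarrier.Plaq d (towerP L m (n + 1)) => c₀) W g p)
  (hSPinv : ∀ (g : PlaqL2K ℂ d (towerP L m (n + 1)) c₀ W) (p : B9SectCLatticeCarrier.Plaq d (towerP L m (n + 1))),
    WL2.equiv ℂ (fun _ : B9SectCLatticeCarrier.Plaq d (towerP L m (n + 1)) => c₀) W (SPinv g) p =
      Complex.exp (-(κ * (χ p.1 : ℂ))) • WL2.equiv ℂ (fun _ : B9SectCLatticeCarrier.Plaq d (towerP L m (n + 1)) => c₀) W g p)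
  {SS SSinv : SiteL2K ℂ d (towerP L m (n + 1)) c₀ W →ₗ[ℂ] SiteL2K ℂ d (towerP L m (n + 1)) c₀ W}
  (hSS : ∀ (g : SiteL2K ℂ d (towerP L m (n + 1)) c₀ W) (x : TSite d (towerP L m (n + 1))),
    WL2.equiv ℂ (fun _ : TSite d (towerP L m (n + 1)) => c₀) W (SS g) x =
      Complex.exp (κ * (χ x : ℂ)) • WL2.equiv ℂ (fun _ : TSite d (towerP L m (n + 1)) => c₀) W g x)
  (hSSinv : ∀ (g : SiteL2K ℂ d (towerP L m (n + 1)) c₀ W) (x : TSite d (towerP L m (n + 1))),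
    WL2.equiv ℂ (fun _ : TSite d (towerP L m (n + 1)) => c₀) W (SSinv g) x =
      Complex.exp (-(κ * (χ x : ℂ))) • WL2.equiv ℂ (fun _ : TSite d (towerP L m (n + 1)) => c₀) W g x)

include hφ hφ' hMφ hMφ' hη hU hV hRSU hRSV hS hSinv hSP hSPinv hSS hSSinv in
/-- **THE SAME WITH THE CURL ∕ DIVERGENCE CLOSENESS LETTERS DISCHARGED**: under the bond closeness `‖U(b) − V(b)‖ ≤ δη` of the two backgrounds
(ne9-leaf-04's (T3)∕(T4) window) the unconjugated letters `e₁`, `e₂` of `B9Eq326ConjugatedDeltaATowerTwoBackgrounds.norm_conjG1k_sub_conjG1k_le` are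
`e₁ = 8√d·M_φM_φ′·δ` (`B9Eq310HessianModePairingTwoBackgrounds.norm_covCurlL2K_sub_le_closeness`) and `e₂ = 2M_φM_φ′δ·√d`
(`B9Eq373DerivativeRemainderTwoBackgrounds.norm_covDivL2K_sub_le₂` with the fibre letter `norm_adTransportW_sub_adTransportW_le`; the `η⁻¹` of `D*` against the
`η` of the closeness) — both ZEROTH order, NO `η`; `e_R` (the `R_k` Lipschitz letter) and `e_Q` (the `Q_k` Lipschitz letter) stay displayed with their tree
suppliers (`B9Eq325RLipschitzSqrtTowerTwoBackgroundsLinear`, `B9Eq315QTowerLipschitzL2TwoBackgrounds`) a consumer's `exact` away. [folklore]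
[cite: Balaban1985BackgroundPropagators, (3.70)–(3.73) pp.404–405, Thm 3.4 p.400, (3.26) p.395, (3.49) p.399, Thm 3.11 p.416] -/
theorem norm_conjG1k_sub_conjG1k_le_of_closeness (ha : 0 ≤ a)
    (hposU : ∀ x : BondL2K ℂ d (towerP L m (n + 1)) c₀ W, x ≠ 0 → 0 < RCLike.re ⟪x, laplaceAk L m n φ η U hL α hα1 hU1U hregU τ (c₀ := c₀) (c₁ := c₁) a x⟫_ℂ)
    (hposV : ∀ x : BondL2K ℂ d (towerP L m (n + 1)) c₀ W, x ≠ 0 → 0 < RCLike.re ⟪x, laplaceAk L m n φ η V hL α hα1 hU1V hregV τ (c₀ := c₀) (c₁ := c₁) a x⟫_ℂ)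
    {γ β βK pK ℓ ρ CP : ℝ} (hγ : 0 < γ) (hβ : 0 ≤ β) (hℓ : 0 ≤ ℓ) (hρ : 0 ≤ ρ) (hρ8 : ρ ≤ 1 / 8) (hCP : 0 ≤ CP)
    (hcoerU : ∀ f : BondL2K ℂ d (towerP L m (n + 1)) c₀ W, γ * ‖f‖ ^ 2 ≤ RCLike.re ⟪f, laplaceAk L m n φ η U hL α hα1 hU1U hregU τ (c₀ := c₀) (c₁ := c₁) a f⟫_ℂ)
    (hcoerV : ∀ f : BondL2K ℂ d (towerP L m (n + 1)) c₀ W, γ * ‖f‖ ^ 2 ≤ RCLike.re ⟪f, laplaceAk L m n φ η V hL α hα1 hU1V hregV τ (c₀ := c₀) (c₁ := c₁) a f⟫_ℂ)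
    (hKreU : ∀ f : BondL2K ℂ d (towerP L m (n + 1)) c₀ W, -(pK * ‖f‖ ^ 2) ≤ RCLike.re ⟪f, curvOp φ τ η U f⟫_ℂ)
    (hKreV : ∀ f : BondL2K ℂ d (towerP L m (n + 1)) c₀ W, -(pK * ‖f‖ ^ 2) ≤ RCLike.re ⟪f, curvOp φ τ η V f⟫_ℂ)
    (hχ : ∀ b : Bond d (towerP L m (n + 1)), |χ (bpos b) - χ (btgt b)| ≤ ℓ * η) (hwin : ‖κ‖ * ℓ * η ≤ 1)
    (hβCC : 4 * ‖κ‖ * ℓ * (Mφ * Mφ') * (d * Real.sqrt d) ≤ β) (hβC : 4 * ‖κ‖ * ℓ * (Mφ * Mφ') * d ≤ β)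
    (hβD : 2 * ‖κ‖ * ℓ * (Mφ * Mφ') * Real.sqrt d ≤ β)
    (QkU QkV : BondL2K ℂ d (towerP L m (n + 1)) c₀ W →ₗ[ℂ] BondL2K ℂ d m c₁ W) (QkU' QkV' : BondL2K ℂ d m c₁ W →ₗ[ℂ] BondL2K ℂ d (towerP L m (n + 1)) c₀ W)
    (hQfacU : ∀ f, S (LinearMap.adjoint (QkW L m n φ U hL α hα1 hU1U hregU (c₀ := c₀) (c₁ := c₁)) (((a : ℝ) : ℂ) • (QkW L m n φ U hL α hα1 hU1U hregU (c₀ := c₀) (c₁ := c₁)) (Sinv f))) = ((a : ℝ) : ℂ) • QkU' (QkU f))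
    (hQfacV : ∀ f, S (LinearMap.adjoint (QkW L m n φ V hL α hα1 hU1V hregV (c₀ := c₀) (c₁ := c₁)) (((a : ℝ) : ℂ) • (QkW L m n φ V hL α hα1 hU1V hregV (c₀ := c₀) (c₁ := c₁)) (Sinv f))) = ((a : ℝ) : ℂ) • QkV' (QkV f))
    (dQU : ∀ f, ‖QkU f - (QkW L m n φ U hL α hα1 hU1U hregU (c₀ := c₀) (c₁ := c₁)) f‖ ≤ β * ‖f‖)
    (dQU' : ∀ g, ‖QkU' g - LinearMap.adjoint (QkW L m n φ U hL α hα1 hU1U hregU (c₀ := c₀) (c₁ := c₁)) g‖ ≤ β * ‖g‖)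
    (dQV : ∀ f, ‖QkV f - (QkW L m n φ V hL α hα1 hU1V hregV (c₀ := c₀) (c₁ := c₁)) f‖ ≤ β * ‖f‖)
    (dQV' : ∀ g, ‖QkV' g - LinearMap.adjoint (QkW L m n φ V hL α hα1 hU1V hregV (c₀ := c₀) (c₁ := c₁)) g‖ ≤ β * ‖g‖)
    (dKU : ∀ f, ‖(S ∘ₗ curvOp φ τ η U ∘ₗ Sinv) f - curvOp φ τ η U f‖ ≤ βK * ‖f‖)
    (dKV : ∀ f, ‖(S ∘ₗ curvOp φ τ η V ∘ₗ Sinv) f - curvOp φ τ η V f‖ ≤ βK * ‖f‖)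
    (dRU : ∀ s, ‖(SS ∘ₗ RofUk L m n φ η U (c₀ := c₀) ∘ₗ SSinv) s - RofUk L m n φ η U (c₀ := c₀) s‖ ≤ ρ * ‖s‖)
    (dRV : ∀ s, ‖(SS ∘ₗ RofUk L m n φ η V (c₀ := c₀) ∘ₗ SSinv) s - RofUk L m n φ η V (c₀ := c₀) s‖ ≤ ρ * ‖s‖)
    (hPU : ∀ f, ‖covDivL2K ℂ c₀ ((η : ℂ))⁻¹ (adTransportW φ fun b => (U b)⁻¹) f -
      RofUk L m n φ η U (c₀ := c₀) (covDivL2K ℂ c₀ ((η : ℂ))⁻¹ (adTransportW φ fun b => (U b)⁻¹) f)‖ ≤ CP * ‖f‖)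
    (hPV : ∀ f, ‖covDivL2K ℂ c₀ ((η : ℂ))⁻¹ (adTransportW φ fun b => (V b)⁻¹) f -
      RofUk L m n φ η V (c₀ := c₀) (covDivL2K ℂ c₀ ((η : ℂ))⁻¹ (adTransportW φ fun b => (V b)⁻¹) f)‖ ≤ CP * ‖f‖)
    (small' : 3 / 4 * pK + (21 + 3 * a) * β ^ 2 + 4 * β * CP + 2 * ρ * CP ^ 2 + βK ≤ γ / 8)
    -- the CONJUGATED two-background letters, lattice form
    {δ₁ δ₂ δR δQ δK : ℝ} (hδ₁ : 0 ≤ δ₁) (hδ₂ : 0 ≤ δ₂) (hδR : 0 ≤ δR) (hδQ : 0 ≤ δQ) (hδK : 0 ≤ δK)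
    (tB₁ : ∀ f, ‖(SP ∘ₗ covCurlL2K ℂ c₀ ((η : ℂ))⁻¹ (adTransportW φ V) ∘ₗ Sinv) f - (SP ∘ₗ covCurlL2K ℂ c₀ ((η : ℂ))⁻¹ (adTransportW φ U) ∘ₗ Sinv) f‖ ≤ δ₁ * ‖f‖)
    (tB₁' : ∀ p, ‖(S ∘ₗ covCoCurlL2K ℂ c₀ ((η : ℂ))⁻¹ (adTransportW φ fun b => (V b)⁻¹) ∘ₗ SPinv) p -
      (S ∘ₗ covCoCurlL2K ℂ c₀ ((η : ℂ))⁻¹ (adTransportW φ fun b => (U b)⁻¹) ∘ₗ SPinv) p‖ ≤ δ₁ * ‖p‖)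
    (tB₂ : ∀ f, ‖(SS ∘ₗ covDivL2K ℂ c₀ ((η : ℂ))⁻¹ (adTransportW φ fun b => (V b)⁻¹) ∘ₗ Sinv) f -
      (SS ∘ₗ covDivL2K ℂ c₀ ((η : ℂ))⁻¹ (adTransportW φ fun b => (U b)⁻¹) ∘ₗ Sinv) f‖ ≤ δ₂ * ‖f‖)
    (tB₂' : ∀ s, ‖(S ∘ₗ covDerivL2K ℂ c₀ ((η : ℂ))⁻¹ (adTransportW φ V) ∘ₗ SSinv) s - (S ∘ₗ covDerivL2K ℂ c₀ ((η : ℂ))⁻¹ (adTransportW φ U) ∘ₗ SSinv) s‖ ≤ δ₂ * ‖s‖)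
    (tR : ∀ s, ‖(SS ∘ₗ RofUk L m n φ η V (c₀ := c₀) ∘ₗ SSinv) s - (SS ∘ₗ RofUk L m n φ η U (c₀ := c₀) ∘ₗ SSinv) s‖ ≤ δR * ‖s‖)
    (tQ : ∀ f, ‖QkV f - QkU f‖ ≤ δQ * ‖f‖) (tQ' : ∀ g, ‖QkV' g - QkU' g‖ ≤ δQ * ‖g‖)
    (tK : ∀ f, ‖(S ∘ₗ curvOp φ τ η V ∘ₗ Sinv) f - (S ∘ₗ curvOp φ τ η U ∘ₗ Sinv) f‖ ≤ δK * ‖f‖)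
    -- the bond closeness of the two backgrounds and the two remaining UNconjugated letters
    {δ eR eQ : ℝ} (hδ : 0 ≤ δ) (heR : 0 ≤ eR) (heQ : 0 ≤ eQ) (hUV : ∀ b, ‖(U b : 𝔸) - (V b : 𝔸)‖ ≤ δ * η)
    (uR : ∀ s, ‖RofUk L m n φ η U (c₀ := c₀) s - RofUk L m n φ η V (c₀ := c₀) s‖ ≤ eR * ‖s‖)
    (uQ : ∀ f, ‖(QkW L m n φ U hL α hα1 hU1U hregU (c₀ := c₀) (c₁ := c₁)) f - (QkW L m n φ V hL α hα1 hU1V hregV (c₀ := c₀) (c₁ := c₁)) f‖ ≤ eQ * ‖f‖)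
    (y : BondL2K ℂ d (towerP L m (n + 1)) c₀ W) :
    ‖(S ∘ₗ G1k L m n φ η V hL α hα1 hU1V hregV τ (c₀ := c₀) (c₁ := c₁) hposV ∘ₗ Sinv) y -
        (S ∘ₗ G1k L m n φ η U hL α hα1 hU1U hregU τ (c₀ := c₀) (c₁ := c₁) hposU ∘ₗ Sinv) y‖ ≤
      (((1 + β) * δ₁ + δ₁ * (1 + β) + δ₁ * δ₁) +
          ((1 + CP + β) * ((1 + ρ) * δ₂ + δR * (1 + CP + β)) + δ₂ * ((1 + ρ) * (1 + CP + β)) + δ₂ * ((1 + ρ) * δ₂ + δR * (1 + CP + β))) +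
          δK + ((Real.sqrt a + |a| * β) * δQ + δQ * (Real.sqrt a + |a| * β) + |a| * (δQ * δQ))) / min (1 / 4) (γ / 8) *
        ((1 + (8 * Real.sqrt d * (Mφ * Mφ') * δ + 2 * Mφ * Mφ' * δ * Real.sqrt d + eR * (1 + CP) + Real.sqrt a * eQ)) * (min (1 / 4) (γ / 8))⁻¹) * ‖y‖ := by
  have hMT' : 0 ≤ 2 * Mφ * Mφ' * (δ * η) := by positivity
  -- `e₁`: the curl closeness letter
  have uB₁ : ∀ f : BondL2K ℂ d (towerP L m (n + 1)) c₀ W,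
      ‖covCurlL2K ℂ c₀ ((η : ℂ))⁻¹ (adTransportW φ U) f - covCurlL2K ℂ c₀ ((η : ℂ))⁻¹ (adTransportW φ V) f‖ ≤ 8 * Real.sqrt d * (Mφ * Mφ') * δ * ‖f‖ :=
    fun f => norm_covCurlL2K_sub_le_closeness φ hMφ hMφ' hφ hφ' hη hU hV hδ hUV f
  -- `e₂`: the divergence closeness letter by adjointness
  have hRR' : ∀ (b : Bond d (towerP L m (n + 1))) (w : W), ‖adTransportW φ U b w - adTransportW φ V b w‖ ≤ 2 * Mφ * Mφ' * (δ * η) * ‖w‖ :=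
    fun b w => norm_adTransportW_sub_adTransportW_le φ hφ hφ' hMφ' U V b (hU b) (hV b) (hUV b) w
  have hηn : ‖((η : ℂ))⁻¹‖ * η = 1 := by rw [norm_inv, Complex.norm_real, Real.norm_eq_abs, abs_of_pos hη, inv_mul_cancel₀ hη.ne']
  have uB₂ : ∀ f : BondL2K ℂ d (towerP L m (n + 1)) c₀ W,
      ‖covDivL2K ℂ c₀ ((η : ℂ))⁻¹ (adTransportW φ fun b => (U b)⁻¹) f - covDivL2K ℂ c₀ ((η : ℂ))⁻¹ (adTransportW φ fun b => (V b)⁻¹) f‖ ≤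
        2 * Mφ * Mφ' * δ * Real.sqrt d * ‖f‖ := fun f => by
    have h := norm_covDivL2K_sub_le₂ (c₀ := c₀) ((η : ℂ))⁻¹ (conj_inv_eta' η) hMT' hRR' hRSU hRSV f
    refine h.trans_eq ?_
    calc ‖((η : ℂ))⁻¹‖ * (2 * Mφ * Mφ' * (δ * η)) * Real.sqrt d * ‖f‖ = 2 * Mφ * Mφ' * δ * (‖((η : ℂ))⁻¹‖ * η) * Real.sqrt d * ‖f‖ := by ring
      _ = 2 * Mφ * Mφ' * δ * Real.sqrt d * ‖f‖ := by rw [hηn, mul_one]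
  exact norm_conjG1k_sub_conjG1k_le L m n φ hφ hφ' hMφ hMφ' hη U V hU hV hRSU hRSV τ hL α hα1 hU1U hregU hU1V hregV a hS hSinv hSP hSPinv hSS hSSinv ha
    hposU hposV hγ hβ hℓ hρ hρ8 hCP hcoerU hcoerV hKreU hKreV hχ hwin hβCC hβC hβD QkU QkV QkU' QkV' hQfacU hQfacV dQU dQU' dQV dQV' dKU dKV dRU dRV hPU hPV
    small' hδ₁ hδ₂ hδR hδQ hδK tB₁ tB₁' tB₂ tB₂' tR tQ tQ' tK (by positivity) (by positivity) heR heQ uB₁ uB₂ uR uQ y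

end Literature.MathematicalPhysics.QuantumFieldTheory.Balaban1983to89.B9Eq326ConjugatedDeltaATowerTwoBackgroundsCloseness

end
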